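import Mathlib
import HarnessLib
import Summits.NavierStokesRegularity.NavierStokesRegularity.Theses.LocalPressureProfileDoor

/-! # BC3 — birth skeleton for the crux K1 `LocalPointZoomSimilarityPressure` (kit-sized).
* `stub_zoomWithSpaceTimeDecay` (S, provable now): the tree zoom `localPointZoomVelGradSlices` (velocity AND gradient
  slices converge along one sequence; profile class; singular apex) PLUS the space–time decay `HasTypeIDecay D v`
  inherited from the local space–time bound (cell lemma `hasTypeIDecay_of_zoom`, r15/Sketch16.lean, rc 0).
* `stub_similarityPressureAlongZoom` (M, load-bearing): along such a zoom the similarity Riesz pressure converges: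
  Riesz covariance Q[λu(x₀+λ·)](z) = λ²Q[u](x₀+λz); near zone by the local C¹ convergence with the uniform
  (scale-invariant) Type-I velocity/gradient bounds and the Calderón–Zygmund representation on balls; intermediate
  shells λL ≤ |x−x₀| ≤ ρ by the space–time bound (≲ M²/L² after the factor (T−tⱼ)); far zone |x−x₀| ≥ ρ by the energy
  bound (≲ E₀ρ⁻³λⱼ²). -/

namespace Summit.NavierStokesRegularity.NavierStokesRegularity.Theses.LocalPressureProfileDoor

/-- stub 1 (S): the tree zoom with space–time decay of the profile. -/
theorem stub_zoomWithSpaceTimeDecay :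
    ∀ (ν T : ℝ), 0 < ν → 0 < T → ∀ (u : ℝ → EuclideanSpace ℝ (Fin 3) → EuclideanSpace ℝ (Fin 3))
      (p : ℝ → EuclideanSpace ℝ (Fin 3) → ℝ),
    Literature.Analysis.FluidPDE.IsClassicalNSSolutionOn (Set.Ico 0 T) ν 0 u p →
    Literature.Analysis.FluidPDE.IsLerayHopfOn T ν 0 (u 0) u →
    Literature.Analysis.FluidPDE.HasRapidSpatialDecay (u 0) →
    ∀ (x₀ : EuclideanSpace ℝ (Fin 3)) (ρ M : ℝ), 0 < ρ →
    (∀ t ∈ Set.Ico 0 T, T - ρ ^ 2 < t → ∀ x ∈ Metric.ball x₀ ρ,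
      ‖u t x‖ * (‖x - x₀‖ + Real.sqrt (ν * (T - t))) ≤ M) →
    ¬ Literature.Analysis.FluidPDE.IsBackwardBoundedAt u T x₀ →
    ∃ (C D : ℝ) (v : ℝ → EuclideanSpace ℝ (Fin 3) → EuclideanSpace ℝ (Fin 3)) (lam : ℕ → ℝ),
      (∀ j, 0 < lam j) ∧ Filter.Tendsto lam Filter.atTop (nhds 0) ∧
      Literature.Analysis.FluidPDE.HasTypeITimeDecay C v ∧ Literature.Analysis.FluidPDE.HasTypeIDecay D v ∧
      ContinuousOn (Function.uncurry v) (Set.Iio (0 : ℝ) ×ˢ Set.univ) ∧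
      (∀ s t : ℝ, s < t → t < 0 → ∀ x, v t x =
        Literature.Analysis.UnboundedOperators.heatExtension (v s) (t - s) x -
          Literature.Analysis.FluidPDE.oseenDuhamel 1 s v v t x) ∧
      (∀ t < 0, Literature.Analysis.FluidPDE.VectorCalculus.IsDivFree (v t)) ∧
      Literature.Analysis.FluidPDE.IsBackwardSingularPoint v 0 ∧
      ∀ s < 0, ∀ y,
        Filter.Tendsto (fun j => (lam j / ν) • u (T + lam j ^ 2 * s / ν) (x₀ + lam j • y)) Filter.atTop
          (nhds (v s y)) ∧
        Filter.Tendsto (fun j => (lam j ^ 2 / ν) •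
          fderiv ℝ (u (T + lam j ^ 2 * s / ν)) (x₀ + lam j • y)) Filter.atTop
          (nhds (fderiv ℝ (v s) y)) := by
  sorry

/-- stub 2 (M, load-bearing): the similarity Riesz pressure converges along a converging zoom. -/
theorem stub_similarityPressureAlongZoom :
    ∀ (ν T : ℝ), 0 < ν → 0 < T → ∀ (u : ℝ → EuclideanSpace ℝ (Fin 3) → EuclideanSpace ℝ (Fin 3))
      (p : ℝ → EuclideanSpace ℝ (Fin 3) → ℝ),
    Literature.Analysis.FluidPDE.IsClassicalNSSolutionOn (Set.Ico 0 T) ν 0 u p →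
    Literature.Analysis.FluidPDE.IsLerayHopfOn T ν 0 (u 0) u →
    Literature.Analysis.FluidPDE.HasRapidSpatialDecay (u 0) →
    ∀ (x₀ : EuclideanSpace ℝ (Fin 3)) (ρ M : ℝ), 0 < ρ →
    (∀ t ∈ Set.Ico 0 T, T - ρ ^ 2 < t → ∀ x ∈ Metric.ball x₀ ρ,
      ‖u t x‖ * (‖x - x₀‖ + Real.sqrt (ν * (T - t))) ≤ M) →
    ∀ (D : ℝ) (v : ℝ → EuclideanSpace ℝ (Fin 3) → EuclideanSpace ℝ (Fin 3)) (lam : ℕ → ℝ),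
    (∀ j, 0 < lam j) → Filter.Tendsto lam Filter.atTop (nhds 0) →
    Literature.Analysis.FluidPDE.HasTypeIDecay D v →
    ContinuousOn (Function.uncurry v) (Set.Iio (0 : ℝ) ×ˢ Set.univ) →
    (∀ s < 0, ∀ y,
        Filter.Tendsto (fun j => (lam j / ν) • u (T + lam j ^ 2 * s / ν) (x₀ + lam j • y)) Filter.atTop
          (nhds (v s y)) ∧
        Filter.Tendsto (fun j => (lam j ^ 2 / ν) •
          fderiv ℝ (u (T + lam j ^ 2 * s / ν)) (x₀ + lam j • y)) Filter.atTop
          (nhds (fderiv ℝ (v s) y))) →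
    ∀ t < 0, ∀ y : EuclideanSpace ℝ (Fin 3),
      Filter.Tendsto (fun j : ℕ => ν⁻¹ * ((T - (T + lam j ^ 2 * t / ν)) *
          Literature.Analysis.FluidPDE.pressurePotential (u (T + lam j ^ 2 * t / ν))
            (x₀ + Real.sqrt (T - (T + lam j ^ 2 * t / ν)) • (Real.sqrt ν • y)))) Filter.atTop
        (nhds ((-t) * Literature.Analysis.FluidPDE.pressurePotential (v t) (Real.sqrt (-t) • y))) := by
  sorry

/-- COMPOSITION (proved): K1 ⇐ stub 1 → stub 2. -/
theorem LocalPointZoomSimilarityPressure_of : LocalPointZoomSimilarityPressure := by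
  intro ν T hν hT u p hcl hLH hdec x₀ ρ M hρ hM hnot
  obtain ⟨C, D, v, lam, hlam, hlam0, hrate, hdecay, hcont, hmild, hdiv, hsing, hconv⟩ :=
    stub_zoomWithSpaceTimeDecay ν T hν hT u p hcl hLH hdec x₀ ρ M hρ hM hnot
  exact ⟨C, D, v, lam, hlam, hlam0, hrate, hdecay, hcont, hmild, hdiv, hsing,
    stub_similarityPressureAlongZoom ν T hν hT u p hcl hLH hdec x₀ ρ M hρ hM D v lam hlam hlam0 hdecay hcont hconv⟩

end Summit.NavierStokesRegularity.NavierStokesRegularity.Theses.LocalPressureProfileDoor
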